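import Mathlib
import Literature.Computability.AlgebraicComplexity.DawarWilsenach2025
import Literature.Computability.AlgebraicComplexity.ValiantConjectureProofs

/-!
# Ryser's formula is a square-symmetric circuit: the cap on the symmetric-circuit method

Dawar–Wilsenach (Thm. 7.1; tree fact `DawarWilsenach2025_thm71`) prove that every family of
square-symmetric arithmetic circuits (Def. 3.7: `LabelledArithCircuit.IsSymmetric` for the diagonal
action of `Sym_n` on the variable matrix `Fin n × Fin n`) computing `per_n` over a field of
characteristic zero has orbit size, hence size, `2^{Ω(n)}`.

This file proves the MATCHING UPPER BOUND inside the same formalism: Ryser's formula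
`per_n = Σ_{S ⊆ [n]} (-1)^{n-|S|} ∏_i Σ_{j ∈ S} x_{j i}` is, read as a labelled DAG, a
square-symmetric circuit with exactly `n² + (n+1)·2ⁿ + 4` gates (`soloInformed_perPoly_squareSymmetric`).
So the square-symmetric complexity of the permanent is `2^{Θ(n)}` in characteristic zero: the
symmetric-circuit lower-bound method is *closed* on the permanent — its bound can never exceed
`2^{O(n)}`, which is also the trivial general upper bound, so nothing about `VP ≠ VNP` can be read off
symmetric size alone (constraint C8 of the solo memo).

Gates: inputs `x_{ij}`; constants `0, 1, -1`; for every `e : Fin n → Bool` (a subset `S`) and column `i`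
an addition gate `L_{i,e} = 0 + Σ_{j ∈ S} x_{j i}`; a multiplication gate
`P_e = 1 · ∏_i L_{i,e} · (-1)^{[n-|S| odd]}`; one output addition gate `Σ_e P_e`.
`σ ∈ Sym_n` acts by `x_{ij} ↦ x_{σ i, σ j}`, `(i, S) ↦ (σ i, σ S)`, `S ↦ σ S`.
-/

open MvPolynomial Finset
open Literature.Computability.AlgebraicComplexity

namespace Summit.ValiantsHypothesis.ValiantsHypothesis.Theorems

namespace SoloInformedRyser

/-- Gates of the Ryser circuit for `per_n`: inputs, three constants, row sums `L_{i,S}`,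
terms `P_S`, output. [folklore] -/
inductive Gate (n : ℕ) : Type
  | var (i j : Fin n)
  | const (k : Fin 3)
  | row (i : Fin n) (e : Fin n → Bool)
  | term (e : Fin n → Bool)
  | out
  deriving DecidableEq

namespace Gate

variable {n : ℕ}

/-- The gate type is a sum of standard finite types. [folklore] -/
def equivSum (n : ℕ) :
    (Fin n × Fin n) ⊕ Fin 3 ⊕ (Fin n × (Fin n → Bool)) ⊕ (Fin n → Bool) ⊕ Unit ≃ Gate n where
  toFun
    | Sum.inl p => var p.1 p.2
    | Sum.inr (Sum.inl k) => const k
    | Sum.inr (Sum.inr (Sum.inl p)) => row p.1 p.2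
    | Sum.inr (Sum.inr (Sum.inr (Sum.inl e))) => term e
    | Sum.inr (Sum.inr (Sum.inr (Sum.inr _))) => out
  invFun
    | var i j => Sum.inl (i, j)
    | const k => Sum.inr (Sum.inl k)
    | row i e => Sum.inr (Sum.inr (Sum.inl (i, e)))
    | term e => Sum.inr (Sum.inr (Sum.inr (Sum.inl e)))
    | out => Sum.inr (Sum.inr (Sum.inr (Sum.inr ())))
  left_inv g := by rcases g with ⟨i, j⟩ | k | ⟨i, e⟩ | e | ⟨⟩ <;> rfl
  right_inv g := by cases g <;> rfl

/-- `instFintype` (soloist, Ryser square-symmetric circuit construction; see module docstring). -/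
instance instFintype (n : ℕ) : Fintype (Gate n) := Fintype.ofEquiv _ (equivSum n)

/-- Gate count: `n² + 3 + n·2ⁿ + 2ⁿ + 1`. [folklore] -/
theorem card_eq (n : ℕ) : Fintype.card (Gate n) = n ^ 2 + 3 + n * 2 ^ n + 2 ^ n + 1 := by
  rw [← Fintype.card_congr (equivSum n)]
  simp only [Fintype.card_sum, Fintype.card_prod, Fintype.card_fin, Fintype.card_fun,
    Fintype.card_bool, Fintype.card_unit]
  ring

/-- `n - |S|`: the number of coordinates where `e` is `false`. [folklore] -/
def negCount (e : Fin n → Bool) : ℕ := (univ.filter fun j => e j = false).card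

/-- The sign child of the term gate `P_S`: the constant `-1` iff `n - |S|` is odd. [folklore] -/
def signSet (e : Fin n → Bool) : Finset (Gate n) :=
  if Odd (negCount e) then {const 2} else ∅

/-- Wires. [folklore] -/
def children : Gate n → Finset (Gate n)
  | var _ _ => ∅
  | const _ => ∅
  | row i e => insert (const 0) ((univ.filter fun j => e j = true).image fun j => var j i)
  | term e => insert (const 1) ((univ.image fun i => row i e) ∪ signSet e)
  | out => univ.image term

/-- Values of the three constant gates: `0, 1, -1`. [folklore] -/
def constVal (F : Type) [Field F] : Fin 3 → F := ![0, 1, -1]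

/-- Labels. [folklore] -/
def label (F : Type) [Field F] : Gate n → CircuitLabel F (Fin n × Fin n)
  | var i j => .var (i, j)
  | const k => .const (constVal F k)
  | row _ _ => .add
  | term _ => .mul
  | out => .add

/-- Layer of a gate (acyclicity). [folklore] -/
def rank : Gate n → ℕ
  | var _ _ => 0
  | const _ => 0
  | row _ _ => 1
  | term _ => 2
  | out => 3

/-- Wires go down in rank. [folklore] -/
theorem rank_lt_of_mem_children {g h : Gate n} (hh : h ∈ children g) : rank h < rank g := by
  cases g with
  | var i j => simp [children] at hh
  | const k => simp [children] at hh
  | row i e =>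
      simp only [children, mem_insert, mem_image, mem_filter, mem_univ, true_and] at hh
      rcases hh with rfl | ⟨j, _, rfl⟩ <;> simp [rank]
  | term e =>
      simp only [children, mem_insert, mem_union, mem_image, mem_univ, true_and] at hh
      rcases hh with rfl | ⟨i, rfl⟩ | hs
      · simp [rank]
      · simp [rank]
      · unfold signSet at hs
        split_ifs at hs
        · rw [mem_singleton] at hs
          subst hs
          simp [rank]
        · simp at hs
  | out =>
      simp only [children, mem_image, mem_univ, true_and] at hh
      rcases hh with ⟨e, rfl⟩
      simp [rank]

/-- Acyclicity. [folklore] -/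
theorem children_wf : WellFounded fun h g : Gate n => h ∈ children g :=
  Subrelation.wf (r := InvImage (· < ·) rank) (fun hh => rank_lt_of_mem_children hh)
    (InvImage.wf rank wellFounded_lt)

/-- Input gates are exactly the childless ones. [folklore] -/
theorem isInput_iff (F : Type) [Field F] (g : Gate n) : (label F g).IsInput ↔ children g = ∅ := by
  cases g with
  | var i j => simp [label, children]
  | const k => simp [label, children]
  | row i e =>
      simp only [label, children, CircuitLabel.not_isInput_add, false_iff]
      exact (insert_nonempty _ _).ne_empty
  | term e =>
      simp only [label, children, CircuitLabel.not_isInput_mul, false_iff]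
      exact (insert_nonempty _ _).ne_empty
  | out =>
      simp only [label, children, CircuitLabel.not_isInput_add, false_iff]
      exact (univ_nonempty.image _).ne_empty

/-- The three constants are distinct in characteristic `≠ 2` (here: zero). [folklore] -/
theorem constVal_injective (F : Type) [Field F] [CharZero F] :
    Function.Injective (constVal F) := by
  intro a b h
  fin_cases a <;> fin_cases b <;> simp [constVal] at h ⊢
  all_goals
    first
      | exact absurd (show (2 : F) = 0 by linear_combination h) two_ne_zero
      | exact absurd (show (2 : F) = 0 by linear_combination -h) two_ne_zero

/-- Distinct input gates carry distinct labels. [folklore] -/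
theorem eq_of_label_eq (F : Type) [Field F] [CharZero F] (g g' : Gate n)
    (hg : (label F g).IsInput) (h : label F g = label F g') : g = g' := by
  cases g <;> cases g' <;> simp_all [label, (constVal_injective F).eq_iff]

/-- **The Ryser circuit** for `per_n` as a labelled DAG (Dawar–Wilsenach Def. 2.2).
[cite: BurgisserClausenShokrollahi1997, Rem. (21.16)(2)] -/
def ryserCircuit (F : Type) [Field F] [CharZero F] (n : ℕ) :
    LabelledArithCircuit F (Fin n × Fin n) Unit (Gate n) where
  children := children
  label := label F
  output := fun _ => out
  wf := children_wf
  isInput_iff := isInput_iff F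
  eq_of_label_eq := eq_of_label_eq F
  output_injective := fun _ _ _ => rfl

/-! ### Symmetry under `Sym_n` acting diagonally -/

/-- The action of `σ ∈ Sym_n` on gates. [folklore] -/
def permFun (σ : Equiv.Perm (Fin n)) : Gate n → Gate n
  | var i j => var (σ i) (σ j)
  | const k => const k
  | row i e => row (σ i) (e ∘ σ.symm)
  | term e => term (e ∘ σ.symm)
  | out => out

/-- `σ⁻¹` undoes `σ` on gates. [folklore] -/
theorem permFun_symm_permFun (σ : Equiv.Perm (Fin n)) (g : Gate n) :
    permFun σ.symm (permFun σ g) = g := by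
  cases g <;> simp [permFun, Function.comp_def]

/-- The action of `σ` on gates as a permutation. [folklore] -/
def perm (σ : Equiv.Perm (Fin n)) : Equiv.Perm (Gate n) where
  toFun := permFun σ
  invFun := permFun σ.symm
  left_inv g := permFun_symm_permFun σ g
  right_inv g := by simpa using permFun_symm_permFun σ.symm g

/-- Reindexing a coordinate filter along `σ`. [folklore] -/
theorem filter_comp_symm (σ : Equiv.Perm (Fin n)) (e : Fin n → Bool) (b : Bool) :
    (univ.filter fun j => (e ∘ σ.symm) j = b) = (univ.filter fun j => e j = b).image σ := by
  ext j
  simp only [mem_filter, mem_univ, true_and, Function.comp_apply, mem_image]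
  constructor
  · intro h
    exact ⟨σ.symm j, h, σ.apply_symm_apply j⟩
  · rintro ⟨j', h, rfl⟩
    simpa using h

/-- `n - |σ S| = n - |S|`. [folklore] -/
theorem negCount_comp_symm (σ : Equiv.Perm (Fin n)) (e : Fin n → Bool) :
    negCount (e ∘ σ.symm) = negCount e := by
  unfold negCount
  rw [filter_comp_symm, card_image_of_injective _ σ.injective]

/-- The sign child is invariant. [folklore] -/
theorem signSet_comp_symm (σ : Equiv.Perm (Fin n)) (e : Fin n → Bool) :
    signSet (e ∘ σ.symm) = (signSet e).image (permFun σ) := by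
  unfold signSet
  rw [negCount_comp_symm]
  split_ifs <;> simp [permFun]

/-- Images of `univ` are invariant under precomposition with a bijection. [folklore] -/
theorem image_comp_equiv_univ {α β : Type*} [Fintype α] [DecidableEq α] [DecidableEq β]
    (τ : α ≃ α) (f : α → β) : univ.image (f ∘ τ) = univ.image f := by
  rw [← image_image, image_univ_of_surjective τ.surjective]

/-- Wires go to wires under `σ`. [folklore] -/
theorem children_permFun (σ : Equiv.Perm (Fin n)) (g : Gate n) :
    children (permFun σ g) = (children g).image (permFun σ) := by
  cases g with
  | var i j => simp [permFun, children]
  | const k => simp [permFun, children]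
  | row i e =>
      show children (row (σ i) (e ∘ σ.symm)) = (children (row i e)).image (permFun σ)
      simp only [children]
      rw [filter_comp_symm, image_image, image_insert, image_image]
      rfl
  | term e =>
      show children (term (e ∘ σ.symm)) = (children (term e)).image (permFun σ)
      simp only [children]
      rw [signSet_comp_symm, image_insert, image_union, image_image,
        ← image_comp_equiv_univ σ (fun i => row i (e ∘ ⇑σ.symm))]
      rfl
  | out =>
      show univ.image term = (univ.image term).image (permFun σ)
      have hs : Function.Surjective fun e : Fin n → Bool => e ∘ ⇑σ.symm := fun e =>
        ⟨e ∘ ⇑σ, by ext j; simp⟩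
      rw [image_image]
      conv_lhs => rw [← image_univ_of_surjective hs, image_image]
      rfl

/-- Labels transform as `σ` prescribes. [folklore] -/
theorem label_permFun (F : Type) [Field F] (σ : Equiv.Perm (Fin n)) (g : Gate n) :
    label F (permFun σ g) = σ • label F g := by
  cases g <;> simp [permFun, label, Prod.smul_mk, Equiv.Perm.smul_def]

/-- **The Ryser circuit is square-symmetric** (Dawar–Wilsenach Def. 3.7 for the diagonal action
of `Sym_n` on `Fin n × Fin n`). [folklore] -/
theorem ryserCircuit_isSymmetric (F : Type) [Field F] [CharZero F] :
    (ryserCircuit F n).IsSymmetric (Equiv.Perm (Fin n)) := fun σ =>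
  ⟨perm σ,
    { children_apply := fun g => by
        rw [map_eq_image]
        exact children_permFun σ g
      label_apply := fun g => label_permFun F σ g
      output_smul := fun _ => rfl }⟩

/-! ### The circuit computes the permanent (Ryser's formula) -/

section Eval

variable (F : Type) [Field F] [CharZero F]

/-- Constant gates. [folklore] -/
theorem eval_const (k : Fin 3) : (ryserCircuit F n).eval (const k) = C (constVal F k) :=
  (ryserCircuit F n).eval_of_label_const (g := const k) rfl

/-- Row gates: `L_{i,S} = Σ_{j ∈ S} x_{j i}`. [folklore] -/
theorem eval_row (i : Fin n) (e : Fin n → Bool) :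
    (ryserCircuit F n).eval (row i e) = ∑ j ∈ univ.filter (fun j => e j = true), X (j, i) := by
  rw [(ryserCircuit F n).eval_of_label_add (g := row i e) rfl]
  change ∑ h ∈ insert (const 0) ((univ.filter fun j => e j = true).image fun j => var j i),
    (ryserCircuit F n).eval h = _
  have h0 : const 0 ∉ (univ.filter fun j => e j = true).image fun j => var j i := by
    simp only [mem_image, not_exists, not_and]
    intro j _ h
    cases h
  rw [sum_insert h0, sum_image fun j _ j' _ h => (var.inj h).1, eval_const]
  simp only [constVal, Matrix.cons_val_zero, map_zero, zero_add]
  exact sum_congr rfl fun j _ => (ryserCircuit F n).eval_of_label_var (g := var j i) rfl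

/-- Term gates: `P_S = (-1)^{n-|S|} ∏_i L_{i,S}`. [folklore] -/
theorem eval_term (e : Fin n → Bool) :
    (ryserCircuit F n).eval (term e) =
      (if Odd (negCount e) then -1 else 1) * ∏ i, (ryserCircuit F n).eval (row i e) := by
  rw [(ryserCircuit F n).eval_of_label_mul (g := term e) rfl]
  change ∏ h ∈ insert (const 1) ((univ.image fun i => row i e) ∪ signSet e),
    (ryserCircuit F n).eval h = _
  have h1 : const 1 ∉ (univ.image fun i => row i e) ∪ signSet e := by
    simp only [mem_union, mem_image, mem_univ, true_and, not_or, not_exists]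
    refine ⟨fun i h => ?_, ?_⟩
    · cases h
    unfold signSet
    split_ifs <;> simp
  have hdisj : Disjoint (univ.image fun i => row i e) (signSet e) := by
    rw [disjoint_left]
    simp only [mem_image, mem_univ, true_and]
    rintro g ⟨i, rfl⟩
    unfold signSet
    split_ifs <;> simp
  have hsign : ∏ h ∈ signSet e, (ryserCircuit F n).eval h =
      if Odd (negCount e) then -1 else 1 := by
    unfold signSet
    split_ifs
    · rw [prod_singleton, eval_const]
      simp [constVal]
    · simp
  rw [prod_insert h1, prod_union hdisj, prod_image fun i _ i' _ h => (row.inj h).1, eval_const,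
    hsign]
  have hc1 : C (constVal F 1) = (1 : MvPolynomial (Fin n × Fin n) F) := by simp [constVal]
  rw [hc1, one_mul, mul_comm]

omit [CharZero F] in
/-- The sign `∏_j (2 e_j - 1) = (-1)^{n - |S|}`. [folklore] -/
theorem sign_eq (e : Fin n → Bool) :
    (∏ j, ((if e j then (1 : MvPolynomial (Fin n × Fin n) F) else 0) +
        (if e j then (1 : MvPolynomial (Fin n × Fin n) F) else 0) + -1)) =
      if Odd (negCount e) then -1 else 1 := by
  have h1 : ∀ b : Bool, ((if b then (1 : MvPolynomial (Fin n × Fin n) F) else 0) +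
      (if b then (1 : MvPolynomial (Fin n × Fin n) F) else 0) + -1) =
      if b = false then -1 else 1 := by
    rintro (_ | _) <;> norm_num
  simp_rw [h1]
  rw [prod_ite, prod_const_one, mul_one, prod_const]
  unfold negCount
  rcases Nat.even_or_odd ((univ.filter fun j => e j = false).card) with h | h
  · rw [h.neg_one_pow, if_neg (Nat.not_odd_iff_even.mpr h)]
  · rw [h.neg_one_pow, if_pos h]

/-- **The Ryser circuit computes the permanent** (Ryser's formula,
`sum_bool_sign_prod_sum_eq_sum_perm`). [cite: BurgisserClausenShokrollahi1997, Rem. (21.16)(2)] -/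
theorem eval_out : (ryserCircuit F n).eval out = perPoly (Fin n) F := by
  rw [(ryserCircuit F n).eval_of_label_add (g := out) rfl]
  change ∑ h ∈ (univ : Finset (Fin n → Bool)).image term, (ryserCircuit F n).eval h = _
  rw [sum_image fun e _ e' _ h => term.inj h]
  simp_rw [eval_term, eval_row]
  rw [show perPoly (Fin n) F = ∑ σ : Equiv.Perm (Fin n), ∏ i, (X (σ i, i) : MvPolynomial _ F) by
      simp [perPoly, Matrix.permanent, Matrix.mvPolynomialX]]
  rw [← sum_bool_sign_prod_sum_eq_sum_perm
      (fun j i => (X (j, i) : MvPolynomial (Fin n × Fin n) F))]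
  refine sum_congr rfl fun e _ => ?_
  rw [sign_eq F e]
  congr 1
  refine prod_congr rfl fun i _ => ?_
  rw [sum_filter]
  exact sum_congr rfl fun j _ => (boole_mul _ _).symm

end Eval

end Gate

end SoloInformedRyser

open SoloInformedRyser in
/-- **Ryser's formula is a square-symmetric circuit of size `n² + (n+1)·2ⁿ + 4`.** For every field
`F` of characteristic zero and every `n` there is a labelled arithmetic circuit over `F` on the
variable matrix `Fin n × Fin n` with one output, symmetric under the diagonal action of `Sym_n`
(Dawar–Wilsenach Def. 3.7, "square-symmetric"), computing `per_n`, with exactly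
`n² + 3 + n·2ⁿ + 2ⁿ + 1` gates. This matches the `2^{Ω(n)}` lower bound of
`DawarWilsenach2025_thm71` up to the constant in the exponent. [folklore] -/
theorem soloInformed_perPoly_squareSymmetric (F : Type) [Field F] [CharZero F] (n : ℕ) :
    ∃ (G : Type) (_ : Fintype G) (C : LabelledArithCircuit F (Fin n × Fin n) Unit G),
      C.IsSymmetric (Equiv.Perm (Fin n)) ∧ C.eval (C.output ()) = perPoly (Fin n) F ∧
        Fintype.card G = n ^ 2 + 3 + n * 2 ^ n + 2 ^ n + 1 :=
  ⟨Gate n, inferInstance, Gate.ryserCircuit F n, Gate.ryserCircuit_isSymmetric F,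
    Gate.eval_out F, Gate.card_eq n⟩

open SoloInformedRyser in
/-- **Cap on the symmetric-circuit method for the permanent**: square-symmetric circuits of size
at most `(n + 5)·2ⁿ + n²` compute `per_n` over any characteristic-zero field, so no lower bound for
square-symmetric circuits computing the permanent can exceed `2^{O(n)}` (cf. the `2^{Ω(n)}` of
`DawarWilsenach2025_thm71`). [folklore] -/
theorem soloInformed_perPoly_squareSymmetric_size_le (F : Type) [Field F] [CharZero F] (n : ℕ) :
    ∃ (G : Type) (_ : Fintype G) (C : LabelledArithCircuit F (Fin n × Fin n) Unit G),
      C.IsSymmetric (Equiv.Perm (Fin n)) ∧ C.eval (C.output ()) = perPoly (Fin n) F ∧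
        Fintype.card G ≤ (n + 5) * 2 ^ n + n ^ 2 := by
  obtain ⟨G, hG, C, h1, h2, h3⟩ := soloInformed_perPoly_squareSymmetric F n
  refine ⟨G, hG, C, h1, h2, ?_⟩
  rw [h3]
  have : 1 ≤ 2 ^ n := Nat.one_le_two_pow
  nlinarith [this]

end Summit.ValiantsHypothesis.ValiantsHypothesis.Theorems
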